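import Summits.HubbardSuperconductivity.HubbardSuperconductivity.Theorems.KLProgrammeKLRegimeFlowReadScaleZeroSunsetCertDefsV2
import Summits.HubbardSuperconductivity.HubbardSuperconductivity.Theorems.KLProgrammeKLRegimeScaleZeroBetaWindowSiteSum
import Summits.HubbardSuperconductivity.HubbardSuperconductivity.Theorems.KLProgrammeKLRegimeScaleZeroCovarianceOffSiteContrForm
import Summits.HubbardSuperconductivity.HubbardSuperconductivity.Theorems.KLProgrammeKLRegimeScaleZeroBetaWindowGridCells

/-!
# Route `KLProgramme`, crux K3 — engine-flow child (stmt-HubbardSuperconductivity-20437), stub (C) at `n = 0`, located item #22a «(C)-SCALE0-PT2»: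
# THE RECORD READER — `ScaleZeroSunsetCertV3 c` ⇒ the NEAR part of the assembly's certified sunset rows `hS0/hS1/hS2`, for every `β ≥ klBetaMin`

Seat hubbard-kl-k3c5-p1 (g14; owner of #22a).  The chain from one μ-cell record (`…SunsetCertDefsV2` §V3: `SunsetCellRecordV3`, `ScaleZeroSunsetCertV3`)
to the lattice rows of `…FlowReadScaleZeroAssembly.twoLegRead_frameZero_of_sunsetData`:
* §1 `certV3_rows` — the certificate eliminates the profiles, the octave table and its parameters: by the generic core
  `siteSum_sunsetShapeT_gridSum_le_of_octaveTable_of_mem` (`…ScaleZeroBetaWindowSiteSum`), for `μ` in the cell, `β ≥ klBetaMin`, grid `β/n ≤ 2⁻¹⁰` and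
  tails `(β/klBetaMin)·T ≤ Tmax`, the site-summed weighted grid sunset sum of the RAW β = ∞ kernels `r_{μ,z}(u) = ‖(1/2π)𝓕G_{μ,z}(u/2π)‖₊` is `≤ row k`;
* §2 `enorm_sunsetTriple_le_shapeT` — ONE off-site pair: p1 g20's profile door (`enorm_gridCov_offSite_le_tsum_profile_of_proj_eq`, centred representative)
  applied to the three covariance factors gives the tail-augmented shape `(E_z(u) + T)²·(E_{−z}(β − u) + T)`, `u = −(τ₁ − τ₀)`;
* §3 `sum_gridTime_sub_eq_sum_range` — the time sum over the shifted grid `(j₀ − j₁)β/N` is the fundamental grid sum (p1's `sum_shiftedGrid_eq_of_periodic`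
  + one reflection);
* §4 **`nearRow_enorm_le`** — THE NEAR ROWS in `ℝ≥0∞`: summing §2 over the times (§3) and over the sites whose centred difference lies in the certified disk
  (injection `x₁ ↦ z_c(x₁ − x₀)`), §1 gives `Σ_{p₁ near} w_k(z_c)‖A₁‖₊‖A₂‖₊‖A₃‖₊ ≤ (N/β)·row k` for every base point, every spin pair, every `β ≥ klBetaMin`,
  with the torus tail read at any `R` with `R + 1 + 2Rc ≤ L` and `N′ ≥ 4`, and the ONE smallness hypothesis `(β/klBetaMin)·(window + torus tail) ≤ Tmax`.
The far sites (`z_c ∉ disk`, i.e. `‖z_c‖∞ > Rc`) are NOT read here (located gap «(2e)-FAR-SITES», KL STATUS 2026-08-28 12:58Z: the hypothesis-free spatial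
door is ≈ 1.6·10²⁴(1+‖z‖∞)⁻⁴, vacuous below ‖z‖∞ ≈ 5·10⁵); the real-valued assembly rows with the far remainder as an explicit input are the next file.

No definitions; nothing here asserts (C), any stub of 20437, K3 or superconductivity.
References: BGM 2006 §2.3 (2.17)–(2.20), §3 (3.2) [cite: BenfattoGiulianiMastropietro2006].
-/

noncomputable section

namespace Summit.HubbardSuperconductivity.HubbardSuperconductivity.Theorems.KLRegimeSplit

set_option linter.dupNamespace false -- summit = problem name (single-conjunct summit), D-0017

open Literature.MathematicalPhysics.QuantumLattice Literature.Probability.LatticeModels Literature.Analysis.FunctionSpaces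
open Summit.HubbardSuperconductivity.HubbardSuperconductivity.Theorems.DispersionFlow
open MeasureTheory Set Finset Complex UnitAddTorus Real GrassmannAlgebra Matrix
open scoped FourierTransform Nat ENNReal NNReal

variable {L M : ℕ} [NeZero L]

/-! ## §1 The certificate eliminates the profiles and the octave table -/

/-- The certified disk is symmetric: `z ∈ disk ⇒ −z ∈ disk`. -/
theorem SunsetCellRecordV2.neg_mem_disk (c : SunsetCellRecordV2) {z : Fin 2 → ℤ} (hz : z ∈ c.disk) : -z ∈ c.disk := by
  rw [SunsetCellRecordV2.mem_disk] at hz ⊢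
  refine ⟨fun j => ?_, neg_ne_zero.2 hz.2⟩
  have h := hz.1 j
  simp only [Pi.neg_apply]
  omega

/-- **The β = ∞ off-site kernel's pointwise size** `r_{μ,z}(u) := ‖(1/2π)·𝓕(G_{μ,z})(u/2π)‖₊` (the RAW profile the door periodises; no definition is
introduced — this abbreviation is spelled out in every statement). -/
theorem certV3_rows (c : SunsetCellRecordV3) (hc : ScaleZeroSunsetCertV3 c) {μ : ℝ} (hμlo : (c.μlo : ℝ) ≤ μ) (hμhi : μ ≤ c.μhi)
    (k : Fin 3) {β : ℝ} (hβ : klBetaMin ≤ β) (n : ℕ) (hn : 0 < n) (hδ : β / n ≤ (2 : ℝ)⁻¹ ^ 10) {T : ℝ≥0∞}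
    (hT : ENNReal.ofReal (β / klBetaMin) * T ≤ ENNReal.ofReal (c.Tmax : ℝ)) :
    ∑ z ∈ c.disk, SunsetCellRecordV2.siteWeight k z * ∑ i ∈ Finset.range n, ENNReal.ofReal (β / n) *
        (((∑' m : ℤ, (‖((1 / (2 * π) : ℝ) : ℂ) * 𝓕 (fun om : ℝ => mFourierCoeff (Torus.descend
            (fun y : Momentum => uvSymbolFn 1 klE0 (frameLevel μ 0 ((2 * π) • y)) om) (uvSpatialSymbol_isLatticePeriodic 1 klE0 μ 0 om))
            (-z)) ((((i : ℝ) + 1) * (β / n) + m * β) / (2 * π))‖₊ : ℝ≥0∞)) + T) ^ 2 *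
          ((∑' m : ℤ, (‖((1 / (2 * π) : ℝ) : ℂ) * 𝓕 (fun om : ℝ => mFourierCoeff (Torus.descend
            (fun y : Momentum => uvSymbolFn 1 klE0 (frameLevel μ 0 ((2 * π) • y)) om) (uvSpatialSymbol_isLatticePeriodic 1 klE0 μ 0 om))
            (-(-z))) ((β - ((i : ℝ) + 1) * (β / n) + m * β) / (2 * π))‖₊ : ℝ≥0∞)) + T)) ≤
      ENNReal.ofReal (c.row k : ℝ) := by
  obtain ⟨K, N, tab, P, hK, hN, hPm, hi, hii, hiii⟩ := hc
  have hβ₀ : (0 : ℝ) < klBetaMin := by norm_num [klBetaMin]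
  exact siteSum_sunsetShapeT_gridSum_le_of_octaveTable_of_mem c.disk (SunsetCellRecordV2.siteWeight k)
    (p := fun z u => (‖((1 / (2 * π) : ℝ) : ℂ) * 𝓕 (fun om : ℝ => mFourierCoeff (Torus.descend
            (fun y : Momentum => uvSymbolFn 1 klE0 (frameLevel μ 0 ((2 * π) • y)) om) (uvSpatialSymbol_isLatticePeriodic 1 klE0 μ 0 om))
            (-z)) (u / (2 * π))‖₊ : ℝ≥0∞))
    (q := fun z u => (‖((1 / (2 * π) : ℝ) : ℂ) * 𝓕 (fun om : ℝ => mFourierCoeff (Torus.descend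
            (fun y : Momentum => uvSymbolFn 1 klE0 (frameLevel μ 0 ((2 * π) • y)) om) (uvSpatialSymbol_isLatticePeriodic 1 klE0 μ 0 om))
            (-(-z))) (u / (2 * π))‖₊ : ℝ≥0∞))
    (pf := P) (qf := fun z => P (-z))
    (fun z hz t u htu => hi μ hμlo hμhi z hz t u htu) (fun z hz t u htu => hi μ hμlo hμhi (-z) (c.neg_mem_disk hz) t u htu)
    hPm (fun z => hPm (-z)) hβ₀ K N hK hN (tab k) (hii k) (hiii k) hβ n hn hδ hT

/-! ## §2 One off-site pair: the three covariance factors under the profile door -/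

/-- **Per-pair sunset majorant**: for grid points `p₁ = (j₁,x₁)`, `p₀ = (j₀,x₀)` with `x₁ ≠ x₀`, any representative `z` of `x₁ − x₀` with
`R + 1 + Σ|z_j| ≤ L`, `N′ ≥ 4`, and spins `σ, σ′`: the product of the three off-site entries of the assembly's sunset is bounded by the
TAIL-AUGMENTED sunset shape of the RAW β = ∞ kernels at `±z`, `(E_z(u) + T)²·(E_{−z}(β − u) + T)`, `u = −(τ₁ − τ₀)`, `T` = the door's two tails. -/
theorem enorm_sunsetTriple_le_shapeT {β : ℝ} (hβ : 0 < β) (hM : 0 < M) (μ : ℝ) {N : ℕ} {p₁ p₀ : GridPoint L N} (hx : p₁.2 ≠ p₀.2)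
    {z : Site 2} (hzx : Torus.proj L z = p₁.2 - p₀.2) (σ σ' : Fin 2) {N' : ℕ} (hN' : 2 * 2 ≤ N') {R : ℕ}
    (hR : (R : ℤ) + 1 + ∑ j, |z j| ≤ L) :
    (‖((hubbardGridSub L M β N).transpose * hubbardCovAboveCT L M β μ 0 0 klE0 * hubbardGridSub L M β N) ((p₁, σ), 0) ((p₀, σ), 1)‖₊ : ℝ≥0∞) *
      ((‖((hubbardGridSub L M β N).transpose * hubbardCovAboveCT L M β μ 0 0 klE0 * hubbardGridSub L M β N) ((p₀, σ'), 0) ((p₁, σ'), 1)‖₊ : ℝ≥0∞) *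
        (‖((hubbardGridSub L M β N).transpose * hubbardCovAboveCT L M β μ 0 0 klE0 * hubbardGridSub L M β N) ((p₁, σ'), 0) ((p₀, σ'), 1)‖₊ : ℝ≥0∞)) ≤
      ((∑' m : ℤ, (‖((1 / (2 * π) : ℝ) : ℂ) * 𝓕 (fun om : ℝ => mFourierCoeff (Torus.descend
            (fun y : Momentum => uvSymbolFn 1 klE0 (frameLevel μ 0 ((2 * π) • y)) om) (uvSpatialSymbol_isLatticePeriodic 1 klE0 μ 0 om))
            (-z)) ((-(gridTime β N p₁.1 - gridTime β N p₀.1) + m * β) / (2 * π))‖₊ : ℝ≥0∞)) +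
          ENNReal.ofReal ((19 / 3) * (4 + |μ| + (0 : TrigPolyC4v).coeffNorm 0) * β / (2 * π ^ 2 * M) +
            (N' ! * klChi2CauchyTab N' * (N' + 1) ! * 4 * (max 1 (4 / klE0)) ^ (N' - 1) * ((2 * π) * 4) ^ N') * (2 / klE0) *
              (1 / (2 * Real.pi) ^ N' * (2 / ((2 * R + 2 : ℕ) : ℝ)) ^ (N' - 2 * 2) * (2 ^ 2 * ∑' k : Site 2, ∏ j, (1 + (k j : ℝ) ^ 2)⁻¹)))) ^ 2 *
        ((∑' m : ℤ, (‖((1 / (2 * π) : ℝ) : ℂ) * 𝓕 (fun om : ℝ => mFourierCoeff (Torus.descend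
            (fun y : Momentum => uvSymbolFn 1 klE0 (frameLevel μ 0 ((2 * π) • y)) om) (uvSpatialSymbol_isLatticePeriodic 1 klE0 μ 0 om))
            (-(-z))) ((β - -(gridTime β N p₁.1 - gridTime β N p₀.1) + m * β) / (2 * π))‖₊ : ℝ≥0∞)) +
          ENNReal.ofReal ((19 / 3) * (4 + |μ| + (0 : TrigPolyC4v).coeffNorm 0) * β / (2 * π ^ 2 * M) +
            (N' ! * klChi2CauchyTab N' * (N' + 1) ! * 4 * (max 1 (4 / klE0)) ^ (N' - 1) * ((2 * π) * 4) ^ N') * (2 / klE0) *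
              (1 / (2 * Real.pi) ^ N' * (2 / ((2 * R + 2 : ℕ) : ℝ)) ^ (N' - 2 * 2) * (2 ^ 2 * ∑' k : Site 2, ∏ j, (1 + (k j : ℝ) ^ 2)⁻¹)))) := by
  -- the three doors
  have hx' : p₀.2 ≠ p₁.2 := fun h => hx h.symm
  have hzx' : Torus.proj L (-z) = p₀.2 - p₁.2 := by
    have : Torus.proj L (-z) = -Torus.proj L z := by
      funext j; simp [Literature.Probability.LatticeModels.Torus.proj_apply]
    rw [this, hzx, neg_sub]
  have hR' : (R : ℤ) + 1 + ∑ j, |(-z) j| ≤ L := by simpa only [Pi.neg_apply, abs_neg] using hR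
  have h1 := enorm_gridCov_offSite_le_tsum_profile_of_proj_eq hβ hM μ hx hzx σ hN' hR
    (p := fun u => (‖((1 / (2 * π) : ℝ) : ℂ) * 𝓕 (fun om : ℝ => mFourierCoeff (Torus.descend
            (fun y : Momentum => uvSymbolFn 1 klE0 (frameLevel μ 0 ((2 * π) • y)) om) (uvSpatialSymbol_isLatticePeriodic 1 klE0 μ 0 om))
            (-z)) (u / (2 * π))‖₊ : ℝ≥0∞)) (fun t => le_rfl)
  have h3 := enorm_gridCov_offSite_le_tsum_profile_of_proj_eq hβ hM μ hx hzx σ' hN' hR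
    (p := fun u => (‖((1 / (2 * π) : ℝ) : ℂ) * 𝓕 (fun om : ℝ => mFourierCoeff (Torus.descend
            (fun y : Momentum => uvSymbolFn 1 klE0 (frameLevel μ 0 ((2 * π) • y)) om) (uvSpatialSymbol_isLatticePeriodic 1 klE0 μ 0 om))
            (-z)) (u / (2 * π))‖₊ : ℝ≥0∞)) (fun t => le_rfl)
  have h2 := enorm_gridCov_offSite_le_tsum_profile_of_proj_eq hβ hM μ hx' hzx' σ' hN' hR'
    (p := fun u => (‖((1 / (2 * π) : ℝ) : ℂ) * 𝓕 (fun om : ℝ => mFourierCoeff (Torus.descend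
            (fun y : Momentum => uvSymbolFn 1 klE0 (frameLevel μ 0 ((2 * π) • y)) om) (uvSpatialSymbol_isLatticePeriodic 1 klE0 μ 0 om))
            (-(-z))) (u / (2 * π))‖₊ : ℝ≥0∞)) (fun t => le_rfl)
  -- the second leg's argument: `−(τ₀ − τ₁) + mβ` re-indexed to `β − u + mβ`, `u = −(τ₁ − τ₀)`
  have hper : (∑' m : ℤ, (‖((1 / (2 * π) : ℝ) : ℂ) * 𝓕 (fun om : ℝ => mFourierCoeff (Torus.descend
            (fun y : Momentum => uvSymbolFn 1 klE0 (frameLevel μ 0 ((2 * π) • y)) om) (uvSpatialSymbol_isLatticePeriodic 1 klE0 μ 0 om))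
            (-(-z))) ((-(gridTime β N p₀.1 - gridTime β N p₁.1) + m * β) / (2 * π))‖₊ : ℝ≥0∞)) =
      ∑' m : ℤ, (‖((1 / (2 * π) : ℝ) : ℂ) * 𝓕 (fun om : ℝ => mFourierCoeff (Torus.descend
            (fun y : Momentum => uvSymbolFn 1 klE0 (frameLevel μ 0 ((2 * π) • y)) om) (uvSpatialSymbol_isLatticePeriodic 1 klE0 μ 0 om))
            (-(-z))) ((β - -(gridTime β N p₁.1 - gridTime β N p₀.1) + m * β) / (2 * π))‖₊ : ℝ≥0∞) := by
    rw [show β - -(gridTime β N p₁.1 - gridTime β N p₀.1) = β + -(gridTime β N p₀.1 - gridTime β N p₁.1) by ring]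
    exact (tsum_profile_add_period (fun u => (‖((1 / (2 * π) : ℝ) : ℂ) * 𝓕 (fun om : ℝ => mFourierCoeff (Torus.descend
            (fun y : Momentum => uvSymbolFn 1 klE0 (frameLevel μ 0 ((2 * π) • y)) om) (uvSpatialSymbol_isLatticePeriodic 1 klE0 μ 0 om))
            (-(-z))) (u / (2 * π))‖₊ : ℝ≥0∞)) β _).symm
  rw [hper] at h2
  calc _ = ((‖((hubbardGridSub L M β N).transpose * hubbardCovAboveCT L M β μ 0 0 klE0 * hubbardGridSub L M β N) ((p₁, σ), 0) ((p₀, σ), 1)‖₊ : ℝ≥0∞) *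
        (‖((hubbardGridSub L M β N).transpose * hubbardCovAboveCT L M β μ 0 0 klE0 * hubbardGridSub L M β N) ((p₁, σ'), 0) ((p₀, σ'), 1)‖₊ : ℝ≥0∞)) *
      (‖((hubbardGridSub L M β N).transpose * hubbardCovAboveCT L M β μ 0 0 klE0 * hubbardGridSub L M β N) ((p₀, σ'), 0) ((p₁, σ'), 1)‖₊ : ℝ≥0∞) := by
        ring
    _ ≤ _ := by rw [sq]; exact mul_le_mul' (mul_le_mul' h1 h3) h2

/-! ## §3 The time sum over the shifted grid is the fundamental grid sum -/

/-- **Time re-indexing**: for a `β`-periodic `G : ℝ → α` and a base time index `j₀`, `Σ_{j₁ : Fin N} G(−(τ_{j₁} − τ_{j₀})) = Σ_{i<N} G((i+1)β/N)`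
(`τ_j = jβ/N`): the differences `(j₀ − j₁)β/N` run over all residues modulo the period. -/
theorem sum_gridTime_sub_eq_sum_range {α : Type*} [AddCommMonoid α] {G : ℝ → α} {β : ℝ} (hG : ∀ t : ℝ, G (t + β) = G t) {N : ℕ}
    (j₀ : Fin N) :
    ∑ j₁ : Fin N, G (-(gridTime β N j₁ - gridTime β N j₀)) = ∑ i ∈ Finset.range N, G (((i : ℝ) + 1) * (β / N)) := by
  have hN : 0 < N := Fin.pos j₀
  have hNr : (0 : ℝ) < N := by exact_mod_cast hN
  -- `G(−t)` is `β`-periodic as well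
  have hG' : ∀ t : ℝ, (fun t => G (-t)) (t + β) = (fun t => G (-t)) t := by
    intro t
    simp only
    rw [← hG (-(t + β)), show -(t + β) + β = -t by ring]
  -- rewrite the shifted grid through p1's periodic re-indexing
  have h1 : ∑ j₁ : Fin N, G (-(gridTime β N j₁ - gridTime β N j₀)) =
      ∑ j ∈ Finset.range N, (fun t => G (-t)) ((((j : ℤ) - (j₀ : ℕ) : ℤ) : ℝ) * β / N) := by
    rw [← Fin.sum_univ_eq_sum_range (fun j => (fun t => G (-t)) ((((j : ℤ) - (j₀ : ℕ) : ℤ) : ℝ) * β / N)) N]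
    refine Finset.sum_congr rfl fun j₁ _ => ?_
    simp only [gridTime]
    congr 1
    push_cast
    ring
  rw [h1, sum_shiftedGrid_eq_of_periodic (F := fun t => G (-t)) hG' j₀.isLt]
  -- reflect the fundamental grid: `−jβ/N ≡ (N − j)β/N`
  rw [← Finset.sum_range_reflect (fun i => G (((i : ℝ) + 1) * (β / N))) N]
  refine Finset.sum_congr rfl fun j hj => ?_
  rw [Finset.mem_range] at hj
  have hcast : (((N - 1 - j : ℕ) : ℝ) + 1) = (N : ℝ) - j := by
    rw [Nat.cast_sub (by omega), Nat.cast_sub (by omega)]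
    push_cast
    ring
  rw [hcast, ← hG (-((j : ℝ) * β / N))]
  congr 1
  field_simp
  ring

/-! ## §4 The near rows: sites of the certified disk -/

/-- **NEAR ROW** (sites `x₁ ≠ x₀` whose centred difference lies in the certified disk), in `ℝ≥0∞`: for `μ` in the cell, `β ≥ klBetaMin`, a time grid
`N ≥ 1` with `β/N ≤ 2⁻¹⁰`, torus-tail parameters `N′ ≥ 4`, `R + 1 + 2Rc ≤ L`, and tails within the allowance `(β/klBetaMin)·T ≤ Tmax`:
`Σ_{p₁ : x₁ ≠ x₀, z_c ∈ disk} w_k(z_c)·‖A₁‖₊‖A₂‖₊‖A₃‖₊ ≤ (N/β)·row k`. -/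
theorem nearRow_enorm_le (c : SunsetCellRecordV3) (hc : ScaleZeroSunsetCertV3 c) {μ : ℝ} (hμlo : (c.μlo : ℝ) ≤ μ) (hμhi : μ ≤ c.μhi)
    (k : Fin 3) {β : ℝ} (hβ : klBetaMin ≤ β) (hM : 0 < M) {N : ℕ} (hN : 0 < N) (hδ : β / N ≤ (2 : ℝ)⁻¹ ^ 10)
    {N' R : ℕ} (hN' : 2 * 2 ≤ N') (hR : R + 1 + 2 * c.Rc ≤ L)
    (hT : ENNReal.ofReal (β / klBetaMin) *
        ENNReal.ofReal ((19 / 3) * (4 + |μ| + (0 : TrigPolyC4v).coeffNorm 0) * β / (2 * π ^ 2 * M) +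
            (N' ! * klChi2CauchyTab N' * (N' + 1) ! * 4 * (max 1 (4 / klE0)) ^ (N' - 1) * ((2 * π) * 4) ^ N') * (2 / klE0) *
              (1 / (2 * Real.pi) ^ N' * (2 / ((2 * R + 2 : ℕ) : ℝ)) ^ (N' - 2 * 2) * (2 ^ 2 * ∑' k : Site 2, ∏ j, (1 + (k j : ℝ) ^ 2)⁻¹))) ≤
      ENNReal.ofReal (c.Tmax : ℝ))
    (σ σ' : Fin 2) (p₀ : GridPoint L N) :
    ∑ p₁ : GridPoint L N, (if p₁.2 ≠ p₀.2 ∧ (fun j => ((p₁.2 - p₀.2) j).valMinAbs : Site 2) ∈ c.disk then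
        SunsetCellRecordV2.siteWeight k (fun j => ((p₁.2 - p₀.2) j).valMinAbs) *
          ((‖((hubbardGridSub L M β N).transpose * hubbardCovAboveCT L M β μ 0 0 klE0 * hubbardGridSub L M β N) ((p₁, σ), 0) ((p₀, σ), 1)‖₊ : ℝ≥0∞) *
            ((‖((hubbardGridSub L M β N).transpose * hubbardCovAboveCT L M β μ 0 0 klE0 * hubbardGridSub L M β N) ((p₀, σ'), 0) ((p₁, σ'), 1)‖₊ : ℝ≥0∞) *
              (‖((hubbardGridSub L M β N).transpose * hubbardCovAboveCT L M β μ 0 0 klE0 * hubbardGridSub L M β N) ((p₁, σ'), 0) ((p₀, σ'), 1)‖₊ : ℝ≥0∞)))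
        else 0) ≤
      ENNReal.ofReal ((N : ℝ) / β) * ENNReal.ofReal (c.row k : ℝ) := by
  classical
  have hβ₀ : (0 : ℝ) < klBetaMin := by norm_num [klBetaMin]
  have hβpos : 0 < β := lt_of_lt_of_le hβ₀ hβ
  have hNr : (0 : ℝ) < N := by exact_mod_cast hN
  -- abbreviations
  set Cg := (hubbardGridSub L M β N).transpose * hubbardCovAboveCT L M β μ 0 0 klE0 * hubbardGridSub L M β N with hCg
  set Tt : ℝ := (19 / 3) * (4 + |μ| + (0 : TrigPolyC4v).coeffNorm 0) * β / (2 * π ^ 2 * M) +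
            (N' ! * klChi2CauchyTab N' * (N' + 1) ! * 4 * (max 1 (4 / klE0)) ^ (N' - 1) * ((2 * π) * 4) ^ N') * (2 / klE0) *
              (1 / (2 * Real.pi) ^ N' * (2 / ((2 * R + 2 : ℕ) : ℝ)) ^ (N' - 2 * 2) * (2 ^ 2 * ∑' k : Site 2, ∏ j, (1 + (k j : ℝ) ^ 2)⁻¹)) with hTt
  set r : Site 2 → ℝ → ℝ≥0∞ := fun z u => (‖((1 / (2 * π) : ℝ) : ℂ) * 𝓕 (fun om : ℝ => mFourierCoeff (Torus.descend
            (fun y : Momentum => uvSymbolFn 1 klE0 (frameLevel μ 0 ((2 * π) • y)) om) (uvSpatialSymbol_isLatticePeriodic 1 klE0 μ 0 om))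
            (-z)) (u / (2 * π))‖₊ : ℝ≥0∞) with hr
  -- the tail-augmented shape of site `z` at time `u`
  set G : Site 2 → ℝ → ℝ≥0∞ := fun z u => ((∑' m : ℤ, r z (u + m * β)) + ENNReal.ofReal Tt) ^ 2 *
    ((∑' m : ℤ, r (-z) (β - u + m * β)) + ENNReal.ofReal Tt) with hGdef
  -- the core: the certified rows bound the site-summed grid sums of `G`
  have core : ∑ z ∈ c.disk, SunsetCellRecordV2.siteWeight k z * ∑ i ∈ Finset.range N, ENNReal.ofReal (β / N) *
      G z (((i : ℝ) + 1) * (β / N)) ≤ ENNReal.ofReal (c.row k : ℝ) := by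
    have h := certV3_rows c hc hμlo hμhi k hβ N hN hδ hT
    simpa only [hGdef, hr, neg_neg] using h
  -- `G z` is `β`-periodic
  have hGper : ∀ z : Site 2, ∀ t : ℝ, G z (t + β) = G z t := by
    intro z t
    simp only [hGdef]
    congr 1
    · rw [tsum_profile_periodic]
    · rw [show β - (t + β) = -t by ring, show β - t = β + -t by ring, tsum_profile_add_period]
  -- centred representative of a site difference
  set zc : TorusSite 2 L → Site 2 := fun x => fun j => ((x - p₀.2) j).valMinAbs with hzc
  have hproj : ∀ x : TorusSite 2 L, Torus.proj L (zc x) = x - p₀.2 := fun x => (two_mul_norm_valMinAbs_le (x - p₀.2)).1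
  have hRz : ∀ x : TorusSite 2 L, zc x ∈ c.disk → (R : ℤ) + 1 + ∑ j, |zc x j| ≤ L := by
    intro x hx
    rw [SunsetCellRecordV2.mem_disk] at hx
    have hj : ∀ j, |zc x j| ≤ c.Rc := fun j => abs_le.2 ⟨(hx.1 j).1, (hx.1 j).2⟩
    have hsum : ∑ j, |zc x j| ≤ 2 * (c.Rc : ℤ) := by
      rw [Fin.sum_univ_two]; linarith [hj 0, hj 1]
    have hRL : ((R + 1 + 2 * c.Rc : ℕ) : ℤ) ≤ L := by exact_mod_cast hR
    push_cast at hRL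
    linarith
  -- Step 1: split the grid points into sites and times, sites outside
  rw [Fintype.sum_prod_type, Finset.sum_comm]
  -- Step 2: per site
  have hsite : ∀ x : TorusSite 2 L,
      ∑ j₁ : Fin N, (if ((j₁, x) : GridPoint L N).2 ≠ p₀.2 ∧ (fun j => ((((j₁, x) : GridPoint L N).2 - p₀.2) j).valMinAbs : Site 2) ∈ c.disk then
        SunsetCellRecordV2.siteWeight k (fun j => ((((j₁, x) : GridPoint L N).2 - p₀.2) j).valMinAbs) *
          ((‖Cg (((j₁, x), σ), 0) ((p₀, σ), 1)‖₊ : ℝ≥0∞) * ((‖Cg ((p₀, σ'), 0) (((j₁, x), σ'), 1)‖₊ : ℝ≥0∞) * (‖Cg (((j₁, x), σ'), 0) ((p₀, σ'), 1)‖₊ : ℝ≥0∞)))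
        else 0) ≤
      if x ≠ p₀.2 ∧ zc x ∈ c.disk then
        SunsetCellRecordV2.siteWeight k (zc x) * (ENNReal.ofReal ((N : ℝ) / β) * ∑ i ∈ Finset.range N, ENNReal.ofReal (β / N) * G (zc x) (((i : ℝ) + 1) * (β / N)))
      else 0 := by
    intro x
    by_cases hcond : x ≠ p₀.2 ∧ zc x ∈ c.disk
    · simp only [hzc] at hcond ⊢
      simp only [hcond, and_self, if_true, ne_eq, not_false_eq_true]
      rw [← Finset.mul_sum]
      refine mul_le_mul' le_rfl ?_
      -- each time: the per-pair door bound, then the periodic re-indexing, then `(N/β)(β/N) = 1`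
      have hpair : ∀ j₁ : Fin N, (‖Cg (((j₁, x), σ), 0) ((p₀, σ), 1)‖₊ : ℝ≥0∞) * ((‖Cg ((p₀, σ'), 0) (((j₁, x), σ'), 1)‖₊ : ℝ≥0∞) *
          (‖Cg (((j₁, x), σ'), 0) ((p₀, σ'), 1)‖₊ : ℝ≥0∞)) ≤ G (zc x) (-(gridTime β N j₁ - gridTime β N p₀.1)) := by
        intro j₁
        have h := enorm_sunsetTriple_le_shapeT (L := L) (M := M) hβpos hM μ (p₁ := ((j₁, x) : GridPoint L N)) (p₀ := p₀) hcond.1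
          (hproj x) σ σ' hN' (hRz x hcond.2)
        simpa only [hGdef, hr, hCg, hTt, add_div] using h
      calc ∑ j₁ : Fin N, (‖Cg (((j₁, x), σ), 0) ((p₀, σ), 1)‖₊ : ℝ≥0∞) * ((‖Cg ((p₀, σ'), 0) (((j₁, x), σ'), 1)‖₊ : ℝ≥0∞) *
            (‖Cg (((j₁, x), σ'), 0) ((p₀, σ'), 1)‖₊ : ℝ≥0∞))
          ≤ ∑ j₁ : Fin N, G (zc x) (-(gridTime β N j₁ - gridTime β N p₀.1)) := Finset.sum_le_sum fun j₁ _ => hpair j₁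
        _ = ∑ i ∈ Finset.range N, G (zc x) (((i : ℝ) + 1) * (β / N)) := sum_gridTime_sub_eq_sum_range (hGper (zc x)) p₀.1
        _ = ENNReal.ofReal ((N : ℝ) / β) * ∑ i ∈ Finset.range N, ENNReal.ofReal (β / N) * G (zc x) (((i : ℝ) + 1) * (β / N)) := by
            rw [Finset.mul_sum]
            refine Finset.sum_congr rfl fun i _ => ?_
            rw [← mul_assoc, ← ENNReal.ofReal_mul (by positivity), show (N : ℝ) / β * (β / N) = 1 by field_simp,
              ENNReal.ofReal_one, one_mul]
    · simp only [hzc] at hcond ⊢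
      simp only [hcond, if_false]
      simp
  refine (Finset.sum_le_sum fun x _ => hsite x).trans ?_
  -- Step 3: collect the sites through the injection `x ↦ z_c(x − x₀)` into the disk
  rw [← Finset.sum_filter]
  have hinj : Set.InjOn zc ↑(Finset.univ.filter fun x : TorusSite 2 L => x ≠ p₀.2 ∧ zc x ∈ c.disk) := by
    intro x _ y _ hxy
    have h := congrArg (Torus.proj L) hxy
    rw [hproj x, hproj y] at h
    exact sub_left_injective h
  have hsub : (Finset.univ.filter fun x : TorusSite 2 L => x ≠ p₀.2 ∧ zc x ∈ c.disk).image zc ⊆ c.disk := by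
    intro z hz
    rw [Finset.mem_image] at hz
    obtain ⟨x, hx, rfl⟩ := hz
    exact (Finset.mem_filter.1 hx).2.2
  calc ∑ x ∈ Finset.univ.filter (fun x : TorusSite 2 L => x ≠ p₀.2 ∧ zc x ∈ c.disk),
        SunsetCellRecordV2.siteWeight k (zc x) * (ENNReal.ofReal ((N : ℝ) / β) * ∑ i ∈ Finset.range N, ENNReal.ofReal (β / N) * G (zc x) (((i : ℝ) + 1) * (β / N)))
      = ENNReal.ofReal ((N : ℝ) / β) * ∑ x ∈ Finset.univ.filter (fun x : TorusSite 2 L => x ≠ p₀.2 ∧ zc x ∈ c.disk),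
          SunsetCellRecordV2.siteWeight k (zc x) * ∑ i ∈ Finset.range N, ENNReal.ofReal (β / N) * G (zc x) (((i : ℝ) + 1) * (β / N)) := by
        rw [Finset.mul_sum]; refine Finset.sum_congr rfl fun x _ => ?_; ring
    _ = ENNReal.ofReal ((N : ℝ) / β) * ∑ z ∈ (Finset.univ.filter fun x : TorusSite 2 L => x ≠ p₀.2 ∧ zc x ∈ c.disk).image zc,
          SunsetCellRecordV2.siteWeight k z * ∑ i ∈ Finset.range N, ENNReal.ofReal (β / N) * G z (((i : ℝ) + 1) * (β / N)) := by
        rw [Finset.sum_image hinj]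
    _ ≤ ENNReal.ofReal ((N : ℝ) / β) * ∑ z ∈ c.disk,
          SunsetCellRecordV2.siteWeight k z * ∑ i ∈ Finset.range N, ENNReal.ofReal (β / N) * G z (((i : ℝ) + 1) * (β / N)) :=
        mul_le_mul' le_rfl (Finset.sum_le_sum_of_subset hsub)
    _ ≤ ENNReal.ofReal ((N : ℝ) / β) * ENNReal.ofReal (c.row k : ℝ) := mul_le_mul' le_rfl core

end Summit.HubbardSuperconductivity.HubbardSuperconductivity.Theorems.KLRegimeSplit

end
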